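import Summits.Ventures.LatticeQCDFlow.Scaling.DensityParityCertificates
import HarnessLib

/-!
# LatticeQCDFlow / Scaling — density parity and the ESS column: pinned by uniform parity, not by parity in model probability

HONEST FRAMING: exact (Metropolis-corrected) sampling algorithms for lattice gauge theory;
figures of merit are autocorrelation/cost numbers at stated couplings and volumes; no
continuum-physics claim.

Venture `LatticeQCDFlow` (cell pub-lqcd), topic `Scaling`; FANOUT row 4 (`s0-u1-b`, rung S0-B:
two independent implementations of the 2D U(1) flow sampler compared column by column).  Companion
of `Scaling/DensityParityCertificates.lean` (same seat, same day), which settles the acceptance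
column (robust to a parity failure of small MODEL mass) and the `τ_int` column (not robust: the
two-point family `p = (1 − ε, ε)`, `q = p`, `q' = (1 − εη, εη)`).  This file does the third
leaderboard column, the reweighting figure of merit: the Kish effective-sample-size fraction
`essFrac p q = (E_q w)²/E_q[w²] = 1/E_p[p/q]` of `Scaling/ImportanceWeights.lean` (`essFrac_eq_inv`,
`Theory2.essFrac_self`, `Theory2.essFrac_pos`).  NEW WORK of the cell, elementary finite sums;
nothing is cited as a fact, no definition is introduced.

## What is proved (finite state space; `p ≥ 0` a probability vector, `q, q' > 0` models)

* **`essFrac_logParity_bounds`** — UNIFORM parity pins the ESS column: `|log q − log q'| ≤ δ`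
  everywhere gives `e^{−δ}·ESS(p, q) ≤ ESS(p, q') ≤ e^{δ}·ESS(p, q)` (termwise
  `p²/q' ≤ e^δ·p²/q` and conversely);
* **`essFrac_parityWitness_le`** — on the two-point family model B has `ESS(p, q') ≤ η/ε`
  (`E_p[p/q'] ≥ ε·ε/(εη) = ε/η`), while model A has `ESS(p, p) = 1`;
* **`exists_essFrac_le_of_logParityOff`** — hence for every `ε ∈ (0, 1)` and every `κ > 0` there
  are a target and two positive models on two points, at log-parity `≤ −log(1 − ε)` off one state
  of mass `≤ ε` under the target and under both models, with `‖q − q'‖_TV ≤ ε` and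
  `|acc(p, q) − acc(p, q')| ≤ ε`, yet `ESS(p, q) = 1` and `ESS(p, q') ≤ κ`.

Reading for row 4 (value-free, no number of ours, no sealed value): the ESS column is a
TARGET-weighted mean of the importance weight, charged exactly where the model under-covers, so —
like `τ_int` and unlike the acceptance — it is certified by a density parity only if that parity is
uniform (sup-norm), not by a parity verified on model draws.  NOT CLAIMED: anything about sample
(estimated) ESS, which has its own blindness (`Scaling/Blindness.lean`); any number re-scored.
-/

namespace Summit.Ventures.LatticeQCDFlow.Theory2.DensityParity

open Finset
open Literature.Probability.MarkovChains
open Summit.Ventures.LatticeQCDFlow.Exactness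

variable {X : Type*} [Fintype X]

section ESS

/-- **Uniform parity pins the ESS column to `e^{±δ}`.**  For a probability vector `p ≥ 0` and
positive models with `|log q x − log q' x| ≤ δ` everywhere:
`e^{−δ}·ESS(p, q) ≤ ESS(p, q') ≤ e^{δ}·ESS(p, q)` (Kish fractions `essFrac`). [folklore] -/
theorem essFrac_logParity_bounds {p q q' : X → ℝ} (hp : ∀ x, 0 ≤ p x) (hp1 : ∑ x, p x = 1)
    (hq : ∀ x, 0 < q x) (hq' : ∀ x, 0 < q' x) {δ : ℝ}
    (hlog : ∀ x, |Real.log (q x) - Real.log (q' x)| ≤ δ) :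
    Real.exp (-δ) * essFrac p q ≤ essFrac p q' ∧ essFrac p q' ≤ Real.exp δ * essFrac p q := by
  -- the two target-weighted mean weights `S = Σ p²/q`, `S' = Σ p²/q'`
  have hS : 0 < ∑ x, p x * weight p q x := by
    have h := essFrac_pos (r := p) hq hp1
    rw [essFrac_eq_inv hq hp1] at h
    exact inv_pos.1 h
  have hS' : 0 < ∑ x, p x * weight p q' x := by
    have h := essFrac_pos (r := p) hq' hp1
    rw [essFrac_eq_inv hq' hp1] at h
    exact inv_pos.1 h
  -- pointwise `q ≤ e^δ q'` and `q' ≤ e^δ q`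
  have hqq : ∀ x, q x ≤ Real.exp δ * q' x ∧ q' x ≤ Real.exp δ * q x := by
    intro x
    have h := hlog x
    rw [abs_sub_le_iff] at h
    constructor
    · have : Real.log (q x) ≤ δ + Real.log (q' x) := by linarith [h.1]
      calc q x = Real.exp (Real.log (q x)) := (Real.exp_log (hq x)).symm
        _ ≤ Real.exp (δ + Real.log (q' x)) := Real.exp_le_exp.2 this
        _ = Real.exp δ * q' x := by rw [Real.exp_add, Real.exp_log (hq' x)]
    · have : Real.log (q' x) ≤ δ + Real.log (q x) := by linarith [h.2]
      calc q' x = Real.exp (Real.log (q' x)) := (Real.exp_log (hq' x)).symm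
        _ ≤ Real.exp (δ + Real.log (q x)) := Real.exp_le_exp.2 this
        _ = Real.exp δ * q x := by rw [Real.exp_add, Real.exp_log (hq x)]
  -- hence `p²/q' ≤ e^δ p²/q` and `p²/q ≤ e^δ p²/q'` termwise
  have hw : ∀ x (a b : ℝ), 0 < a → 0 < b → a ≤ Real.exp δ * b →
      p x * (p x / b) ≤ Real.exp δ * (p x * (p x / a)) := by
    intro x a b ha hb hab
    have hab' : a / b ≤ Real.exp δ := by rwa [div_le_iff₀ hb]
    have hpa : 0 ≤ p x * (p x / a) := mul_nonneg (hp x) (div_nonneg (hp x) ha.le)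
    have ha' : a ≠ 0 := ha.ne'
    have hb' : b ≠ 0 := hb.ne'
    calc p x * (p x / b) = p x * (p x / a) * (a / b) := by
          field_simp
      _ ≤ p x * (p x / a) * Real.exp δ := mul_le_mul_of_nonneg_left hab' hpa
      _ = Real.exp δ * (p x * (p x / a)) := mul_comm _ _
  have hS'le : ∑ x, p x * weight p q' x ≤ Real.exp δ * ∑ x, p x * weight p q x := by
    rw [mul_sum]
    exact sum_le_sum fun x _ => by
      unfold weight
      exact hw x (q x) (q' x) (hq x) (hq' x) (hqq x).1
  have hSle : ∑ x, p x * weight p q x ≤ Real.exp δ * ∑ x, p x * weight p q' x := by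
    rw [mul_sum]
    exact sum_le_sum fun x _ => by
      unfold weight
      exact hw x (q' x) (q x) (hq' x) (hq x) (hqq x).2
  rw [essFrac_eq_inv hq hp1, essFrac_eq_inv hq' hp1]
  have hexp : Real.exp (-δ) = (Real.exp δ)⁻¹ := Real.exp_neg δ
  constructor
  · rw [hexp, ← mul_inv, inv_le_inv₀ (mul_pos (Real.exp_pos δ) hS) hS']
    exact hS'le
  · have h1 : Real.exp δ * (∑ x, p x * weight p q x)⁻¹
        = ((Real.exp δ)⁻¹ * ∑ x, p x * weight p q x)⁻¹ := by
      rw [mul_inv, inv_inv]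
    rw [h1, inv_le_inv₀ hS' (mul_pos (inv_pos.2 (Real.exp_pos δ)) hS),
      inv_mul_le_iff₀ (Real.exp_pos δ)]
    exact hSle

/-- **Model B's ESS on the two-point family is at most `η/ε`**: with `p = (1 − ε, ε)`,
`q' = (1 − εη, εη)` (`0 < ε < 1`, `0 < η ≤ 1`), `E_p[p/q'] ≥ ε·(ε/(εη)) = ε/η`, so
`essFrac p q' ≤ η/ε` — while model A (`q = p`) has `essFrac p p = 1` (`Theory2.essFrac_self`). -/
theorem essFrac_parityWitness_le {ε η : ℝ} (hε : 0 < ε) (hε1 : ε < 1) (hη : 0 < η) (hη1 : η ≤ 1) :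
    essFrac (![1 - ε, ε] : Fin 2 → ℝ) ![1 - ε * η, ε * η] ≤ η / ε := by
  have hεη0 : 0 < ε * η := mul_pos hε hη
  have hεη1 : ε * η < 1 := by nlinarith
  have hpos' := parityWitness_pos hεη0 hεη1
  rw [essFrac_eq_inv hpos' (sum_parityWitness ε)]
  have hS : ε / η ≤ ∑ i, (![1 - ε, ε] : Fin 2 → ℝ) i * weight ![1 - ε, ε] ![1 - ε * η, ε * η] i := by
    unfold weight
    rw [Fin.sum_univ_two]
    simp only [Matrix.cons_val_zero, Matrix.cons_val_one]
    have h0 : 0 ≤ (1 - ε) * ((1 - ε) / (1 - ε * η)) :=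
      mul_nonneg (by linarith) (div_nonneg (by linarith) (by linarith))
    rw [div_mul_eq_div_div, div_self hε.ne', mul_one_div]
    linarith
  have hεη : 0 < ε / η := div_pos hε hη
  calc (∑ i, (![1 - ε, ε] : Fin 2 → ℝ) i * weight ![1 - ε, ε] ![1 - ε * η, ε * η] i)⁻¹
      ≤ (ε / η)⁻¹ := (inv_le_inv₀ (hεη.trans_le hS) hεη).2 hS
    _ = η / ε := inv_div ε η

/-- **The ESS column has no law in model probability either.**  For every `ε ∈ (0, 1)` and every
`κ > 0` there are, on two points, a target `p` and two positive models `q = p`, `q'` (probability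
vectors) at log-parity `≤ −log(1 − ε)` off the single state `1`, whose mass is `≤ ε` under the
target and under both models, with `‖q − q'‖_TV ≤ ε` and `|acc(p, q) − acc(p, q')| ≤ ε`, yet
`essFrac p q = 1` and `essFrac p q' ≤ κ`.  (Witness: `q' = (1 − εη, εη)`, `η = min 1 (κ ε)`.)
[folklore] -/
theorem exists_essFrac_le_of_logParityOff {ε : ℝ} (hε : 0 < ε) (hε1 : ε < 1) {κ : ℝ} (hκ : 0 < κ) :
    ∃ p q q' : Fin 2 → ℝ, (∀ i, 0 < p i) ∧ (∀ i, 0 < q i) ∧ (∀ i, 0 < q' i) ∧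
      ∑ i, p i = 1 ∧ ∑ i, q i = 1 ∧ ∑ i, q' i = 1 ∧ q = p ∧
      |Real.log (q 0) - Real.log (q' 0)| ≤ -Real.log (1 - ε) ∧
      p 1 ≤ ε ∧ q 1 ≤ ε ∧ q' 1 ≤ ε ∧
      tvDist q q' ≤ ε ∧ |accRate p q - accRate p q'| ≤ ε ∧
      essFrac p q = 1 ∧ essFrac p q' ≤ κ := by
  set η : ℝ := min 1 (κ * ε) with hηdef
  have hη0 : 0 < η := lt_min one_pos (mul_pos hκ hε)
  have hη1 : η ≤ 1 := min_le_left _ _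
  have hηκ : η ≤ κ * ε := min_le_right _ _
  have hpos := parityWitness_pos hε hε1
  have hεη0 : 0 < ε * η := mul_pos hε hη0
  have hεη1 : ε * η < 1 := by nlinarith
  have hpos' := parityWitness_pos hεη0 hεη1
  refine ⟨![1 - ε, ε], ![1 - ε, ε], ![1 - ε * η, ε * η], hpos, hpos, hpos', sum_parityWitness ε,
    sum_parityWitness ε, sum_parityWitness (ε * η), rfl,
    abs_log_parityWitness_off_le hε.le hε1 hη0.le hη1, ?_, ?_, ?_, ?_, ?_,
    essFrac_self hpos (sum_parityWitness ε), ?_⟩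
  · show ε ≤ ε
    exact le_rfl
  · show ε ≤ ε
    exact le_rfl
  · show ε * η ≤ ε
    nlinarith
  · rw [tvDist_parityWitness hε.le hη1]
    nlinarith
  · rw [accRate_self_eq_one (sum_parityWitness ε), accRate_parityWitness hε.le hη1,
      show (1 : ℝ) - (1 - ε * (1 - η)) = ε * (1 - η) by ring,
      abs_of_nonneg (mul_nonneg hε.le (by linarith))]
    nlinarith
  · refine (essFrac_parityWitness_le hε hε1 hη0 hη1).trans ?_
    rw [div_le_iff₀ hε]
    exact hηκ

end ESS

end Summit.Ventures.LatticeQCDFlow.Theory2.DensityParity
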